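import Summits.KontsevichZagierPeriods.KontsevichZagierPeriods.Theorems.RootDecompWalshStrataConicDescent
import Summits.KontsevichZagierPeriods.KontsevichZagierPeriods.Theorems.RootDecompWalshStrataOctantPolar

/-!
# Ball-cube descent 1/7: quadric normal form `Quadric₃` and adapted atoms; the specimen `K₇`; the fibrewise vertex chart

Gen 5 of the decomposition node `WalshStrata` (route `RootDecompWalshStrata`, support item
`QuadricBakerDescent` stmt-KontsevichZagierPeriods-27597, its `d = 3` slice): the first two-variable
`√(quadratic)` weight over CUBE-CUT cells decided inside KZ's rules (1)–(3) over `ℚ` —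
`sqrtDescent₂_ball : ∀ γ, SqrtDescent₂ K₇ γ` (part 6) for the ball quadric `P = 7/4 − x² − y² − z²`
(`D = 7 − 4x² − 4y²`; atoms = the disc `x² + y² < 3/4` and the annulus `3/4 < x² + y² < 7/4` cut by
the faces `x = 1`, `y = 1`, plus null/empty/zero-weight atoms), and the corollary
`ballCube_bakerDescent` (part 7): `(d, P, q) = (3, 7/4 − Σxᵢ², q)` is an instance of
`QuadricBakerDescent` for every `q ∈ ℚ`.  Mechanism: the fibrewise vertex chart
`(v, x) ↦ (x, s(x)·v/(1 + v²))`, `s = √(7 − 4x²)`, makes `√D·|det| = (7 − 4x²)(1 − v²)²/(1 + v²)³`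
RATIONAL; Newton–Leibniz in `x` over an arbitrary semialgebraic base (the landed band identity); the
`√(7 − 4x²)`-CANCELLATION on the algebraic edges `x² = β(v)` (circle) and `x² = α(v)` (face `y = 1`)
under the charts `v₁ = 2p/(s + 2)`, `v₂ = 2/(s + 2p)` (`p = √(3/4 − x²)`) reduces both boundary terms to
`E(x²)·√(3/4 − x²)`, `E ∈ ℚ(X)`, hence to rational integrands by the Euler chart of `x² + y² = 3/4`.
This part: the typed layer `Quadric₃` / `adapted` / `atom` (verbatim from the lens file §21; the
target `SqrtDescent₂` itself is declared in part 6 next to its proof), the specimen `K₇` and its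
adapted functions, the two non-degenerate atoms `R₁`, `R₂`, and the chart `chΦ` with its Jacobian
`chΦ'`, determinant and injectivity on `(0,1)²`.
Imports: the landed conic descent 7/7 and octant polar part (for `boxTwo`, `euler_inj`); 0 sorry.
[KontsevichZagier2001 §1.2; BCR1998 §2.2]
-/

noncomputable section

open Literature.NumberTheory.Transcendental
open MeasureTheory Set
open MvPolynomial (aeval X C)
open Literature.ModelTheory.ExponentialFields (IsSemialgebraic isSemialgebraic_univ
  isSemialgebraic_setOf_eval_pos isSemialgebraic_setOf_eval_lt isSemialgebraic_setOf_eval_le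
  isSemialgebraic_setOf_eval_nonneg isSemialgebraic_setOf_eval_eq_zero continuous_aeval_real
  tarski_seidenberg_real_holds)
open Summit.KontsevichZagierPeriods.RootDecompWalshStrata.WalshSpanProof (isSemialgebraic_cubeSet
  isBounded_cubeSet)
open Summit.KontsevichZagierPeriods.RootDecompWalshStrata.ConeSpecimen (unitIoo isSemialgebraic_unitIoo
  unitIoo_subset_Icc mem_unitIoo)
open Summit.KontsevichZagierPeriods.RootDecompWalshStrata.PointlessOctant (boxTwo isSemialgebraic_boxTwo
  boxTwo_subset_Icc euler_inj)

namespace Summit.KontsevichZagierPeriods.RootDecompWalshStrata.ConicDescent.BallCube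

/-! #### 21. Quadric normal form in three variables and adapted atoms (lens file §21) -/

/-- Coefficients of a quadric `A z² + (b₀ + b₁ x + b₂ y) z + (c₀ + c₁ x + c₂ y + c₁₁ x² + c₁₂ x y
+ c₂₂ y²)` over `ℚ` — the normal form of a total-degree-`≤ 2` polynomial in three variables with
the last variable as fibre (the `d = 3` analogue of `Conic`). -/
structure Quadric₃ where
  /-- the coefficient `A` of `z²` -/
  A : ℚ
  /-- `B(x,y) = b₀ + b₁ x + b₂ y`: the constant coefficient -/
  b0 : ℚ
  /-- `B`: the coefficient of `x` -/
  b1 : ℚ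
  /-- `B`: the coefficient of `y` -/
  b2 : ℚ
  /-- `C(x,y) = c₀ + c₁ x + c₂ y + c₁₁ x² + c₁₂ xy + c₂₂ y²`: the constant coefficient -/
  c0 : ℚ
  /-- `C`: the coefficient of `x` -/
  c1 : ℚ
  /-- `C`: the coefficient of `y` -/
  c2 : ℚ
  /-- `C`: the coefficient of `x²` -/
  c11 : ℚ
  /-- `C`: the coefficient of `xy` -/
  c12 : ℚ
  /-- `C`: the coefficient of `y²` -/
  c22 : ℚ

namespace Quadric₃

variable (K : Quadric₃)

/-- `B(x, y) = b₀ + b₁ x + b₂ y`. -/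
def Bxy (x y : ℝ) : ℝ := K.b0 + K.b1 * x + K.b2 * y
/-- `C(x, y) = P(x, y, 0)`, the face conic at `z = 0`. -/
def Cxy (x y : ℝ) : ℝ := K.c0 + K.c1 * x + K.c2 * y + K.c11 * x ^ 2 + K.c12 * x * y + K.c22 * y ^ 2
/-- The fibre discriminant `D(x, y) = B² − 4 A C`. -/
def Dxy (x y : ℝ) : ℝ := K.Bxy x y ^ 2 - 4 * K.A * K.Cxy x y
/-- The quadric polynomial function `p(x, y, z)`. -/
def pxyz (x y z : ℝ) : ℝ := K.A * z ^ 2 + K.Bxy x y * z + K.Cxy x y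
/-- `P(x, y, 1) = A + B + C`, the face conic at `z = 1`. -/
def C1xy (x y : ℝ) : ℝ := K.A + K.Bxy x y + K.Cxy x y

/-- The five ADAPTED polynomial functions whose sign conditions cut the base `(0,1)²` into the
pieces produced by clamping the fibre roots `(−B ± √D)/(2A)` to `[0, 1]`:
`D`, `C₀ = P(·,·,0)`, `C₁ = P(·,·,1)`, `B`, `2A + B`.  On `{C₀ = 0}` one has `D = B²`, on
`{C₁ = 0}` one has `D = (2A + B)²` — the adaptedness that keeps every boundary curve of genus 0. -/
def adapted : Fin 5 → (Fin 2 → ℝ) → ℝ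
  | ⟨0, _⟩ => fun v => K.Dxy (v 0) (v 1)
  | ⟨1, _⟩ => fun v => K.Cxy (v 0) (v 1)
  | ⟨2, _⟩ => fun v => K.C1xy (v 0) (v 1)
  | ⟨3, _⟩ => fun v => K.Bxy (v 0) (v 1)
  | ⟨_ + 4, _⟩ => fun v => 2 * K.A + K.Bxy (v 0) (v 1)

/-- The ATOM of the adapted sign algebra with sign vector `σ` inside the open unit square. -/
def atom (σ : Fin 5 → SignType) : Set (Fin 2 → ℝ) :=
  {v | (∀ j, 0 < v j ∧ v j < 1) ∧ ∀ i, SignType.sign (K.adapted i v) = σ i}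

/-- Adaptedness, face `z = 0`: on `{C₀ = 0}` the discriminant is the square `B²`. -/
theorem Dxy_eq_sq_of_Cxy_eq_zero {x y : ℝ} (h : K.Cxy x y = 0) : K.Dxy x y = K.Bxy x y ^ 2 := by
  simp [Dxy, h]

/-- Adaptedness, face `z = 1`: on `{C₁ = 0}` the discriminant is the square `(2A + B)²`. -/
theorem Dxy_eq_sq_of_C1xy_eq_zero {x y : ℝ} (h : K.C1xy x y = 0) :
    K.Dxy x y = (2 * K.A + K.Bxy x y) ^ 2 := by
  have hC : K.Cxy x y = -(K.A + K.Bxy x y) := by rw [C1xy] at h; linarith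
  simp only [Dxy, hC]; ring

/-- The weighted quadric Walsh cell `{(x,y,z) ∈ (0,1)³ | p(x,y,z) > 0}`. -/
def cell : Set (Fin 3 → ℝ) := {z | (∀ j, 0 < z j ∧ z j < 1) ∧ 0 < K.pxyz (z 0) (z 1) (z 2)}

end Quadric₃

/-! #### 23.1 The specimen and its adapted functions -/

/-- The quadric normal form of `P = 7/4 − x² − y² − z²`. -/
def K₇ : Quadric₃ := ⟨-1, 0, 0, 0, 7 / 4, 0, 0, -1, 0, -1⟩

/-- Lemma `K₇_Bxy` of the ball-cube descent (gen 5; see the section docstring). [this node] -/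
theorem K₇_Bxy (x y : ℝ) : K₇.Bxy x y = 0 := by
  simp [K₇, Quadric₃.Bxy]

/-- Lemma `K₇_Cxy` of the ball-cube descent (gen 5; see the section docstring). [this node] -/
theorem K₇_Cxy (x y : ℝ) : K₇.Cxy x y = 7 / 4 - x ^ 2 - y ^ 2 := by
  simp only [K₇, Quadric₃.Cxy]; push_cast; ring

/-- Lemma `K₇_Dxy` of the ball-cube descent (gen 5; see the section docstring). [this node] -/
theorem K₇_Dxy (x y : ℝ) : K₇.Dxy x y = 7 - 4 * x ^ 2 - 4 * y ^ 2 := by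
  simp only [Quadric₃.Dxy, K₇_Bxy, K₇_Cxy]; simp only [K₇]; push_cast; ring

/-- Lemma `K₇_C1xy` of the ball-cube descent (gen 5; see the section docstring). [this node] -/
theorem K₇_C1xy (x y : ℝ) : K₇.C1xy x y = 3 / 4 - x ^ 2 - y ^ 2 := by
  simp only [Quadric₃.C1xy, K₇_Bxy, K₇_Cxy]; simp only [K₇]; push_cast; ring

/-- Lemma `K₇_twoA` of the ball-cube descent (gen 5; see the section docstring). [this node] -/
theorem K₇_twoA (x y : ℝ) : 2 * (K₇.A : ℝ) + K₇.Bxy x y = -2 := by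
  rw [K₇_Bxy]; simp only [K₇]; push_cast; ring

/-- Lemma `K₇_adapted₀` of the ball-cube descent (gen 5; see the section docstring). [this node] -/
theorem K₇_adapted₀ (v : Fin 2 → ℝ) : K₇.adapted 0 v = 7 - 4 * v 0 ^ 2 - 4 * v 1 ^ 2 := by
  show K₇.Dxy (v 0) (v 1) = _; exact K₇_Dxy _ _

/-- Lemma `K₇_adapted₁` of the ball-cube descent (gen 5; see the section docstring). [this node] -/
theorem K₇_adapted₁ (v : Fin 2 → ℝ) : K₇.adapted 1 v = 7 / 4 - v 0 ^ 2 - v 1 ^ 2 := by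
  show K₇.Cxy (v 0) (v 1) = _; exact K₇_Cxy _ _

/-- Lemma `K₇_adapted₂` of the ball-cube descent (gen 5; see the section docstring). [this node] -/
theorem K₇_adapted₂ (v : Fin 2 → ℝ) : K₇.adapted 2 v = 3 / 4 - v 0 ^ 2 - v 1 ^ 2 := by
  show K₇.C1xy (v 0) (v 1) = _; exact K₇_C1xy _ _

/-- Lemma `K₇_adapted₃` of the ball-cube descent (gen 5; see the section docstring). [this node] -/
theorem K₇_adapted₃ (v : Fin 2 → ℝ) : K₇.adapted 3 v = 0 := by
  show K₇.Bxy (v 0) (v 1) = _; exact K₇_Bxy _ _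

/-- Lemma `K₇_adapted₄` of the ball-cube descent (gen 5; see the section docstring). [this node] -/
theorem K₇_adapted₄ (v : Fin 2 → ℝ) : K₇.adapted 4 v = -2 := by
  show 2 * (K₇.A : ℝ) + K₇.Bxy (v 0) (v 1) = _; exact K₇_twoA _ _

/-! #### 23.2 The two non-degenerate atoms -/

/-- The disc piece `R₁ = (0,1)² ∩ {x² + y² < 3/4}`. -/
def R₁ : Set (Fin 2 → ℝ) := {u | (∀ j, 0 < u j ∧ u j < 1) ∧ u 0 ^ 2 + u 1 ^ 2 < 3 / 4}

/-- The annulus piece `R₂ = (0,1)² ∩ {3/4 < x² + y² < 7/4}`. -/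
def R₂ : Set (Fin 2 → ℝ) :=
  {u | (∀ j, 0 < u j ∧ u j < 1) ∧ 3 / 4 < u 0 ^ 2 + u 1 ^ 2 ∧ u 0 ^ 2 + u 1 ^ 2 < 7 / 4}

/-- Lemma `R₁_subset_boxTwo` of the ball-cube descent (gen 5; see the section docstring). [this node] -/
theorem R₁_subset_boxTwo : R₁ ⊆ boxTwo := fun _ hu => hu.1

/-- Lemma `R₂_subset_boxTwo` of the ball-cube descent (gen 5; see the section docstring). [this node] -/
theorem R₂_subset_boxTwo : R₂ ⊆ boxTwo := fun _ hu => hu.1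

/-- Lemma `isSemialgebraic_R₁` of the ball-cube descent (gen 5; see the section docstring). [this node] -/
theorem isSemialgebraic_R₁ : IsSemialgebraic ℚ R₁ := by
  have h := isSemialgebraic_boxTwo.inter (isSemialgebraic_setOf_eval_pos (k := ℚ) (R := ℝ)
    (3 - 4 * X 0 ^ 2 - 4 * X 1 ^ 2 : MvPolynomial (Fin 2) ℚ))
  convert h using 1
  ext u
  simp only [R₁, boxTwo, mem_inter_iff, mem_setOf_eq, map_sub, map_mul, map_pow, MvPolynomial.aeval_X, map_ofNat]
  constructor
  · rintro ⟨hb, h1⟩; exact ⟨hb, by linarith⟩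
  · rintro ⟨hb, h1⟩; exact ⟨hb, by linarith⟩

/-- Lemma `isSemialgebraic_R₂` of the ball-cube descent (gen 5; see the section docstring). [this node] -/
theorem isSemialgebraic_R₂ : IsSemialgebraic ℚ R₂ := by
  have h := (isSemialgebraic_boxTwo.inter (isSemialgebraic_setOf_eval_pos (k := ℚ) (R := ℝ)
    (4 * X 0 ^ 2 + 4 * X 1 ^ 2 - 3 : MvPolynomial (Fin 2) ℚ))).inter
    (isSemialgebraic_setOf_eval_pos (k := ℚ) (R := ℝ)
      (7 - 4 * X 0 ^ 2 - 4 * X 1 ^ 2 : MvPolynomial (Fin 2) ℚ))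
  convert h using 1
  ext u
  simp only [R₂, boxTwo, mem_inter_iff, mem_setOf_eq, map_sub, map_mul, map_pow, MvPolynomial.aeval_X, map_ofNat,
    map_add]
  constructor
  · rintro ⟨hb, h1, h2⟩; exact ⟨⟨hb, by linarith⟩, by linarith⟩
  · rintro ⟨⟨hb, h1⟩, h2⟩; exact ⟨hb, by linarith, by linarith⟩

/-! #### 23.3 The fibrewise vertex chart `Φ(v, x) = (x, s(x)·v/(1 + v²))` -/

/-- `s(x) = √(7 − 4x²)` (`D(x, y) = s(x)² − 4y²`). -/
def chS (x : ℝ) : ℝ := √(7 - 4 * x ^ 2)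

/-- Lemma `chS_nonneg` of the ball-cube descent (gen 5; see the section docstring). [this node] -/
theorem chS_nonneg (x : ℝ) : 0 ≤ chS x := Real.sqrt_nonneg _

/-- Lemma `chS_sq` of the ball-cube descent (gen 5; see the section docstring). [this node] -/
theorem chS_sq {x : ℝ} (hx : x ^ 2 ≤ 7 / 4) : chS x ^ 2 = 7 - 4 * x ^ 2 :=
  Real.sq_sqrt (by linarith)

/-- Lemma `chS_pos` of the ball-cube descent (gen 5; see the section docstring). [this node] -/
theorem chS_pos {x : ℝ} (hx : x ^ 2 < 7 / 4) : 0 < chS x :=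
  Real.sqrt_pos.2 (by linarith)

/-- `s(x) > 2` when `x² < 3/4`. -/
theorem two_lt_chS {x : ℝ} (hx : x ^ 2 < 3 / 4) : 2 < chS x := by
  have h2 := chS_sq (show x ^ 2 ≤ 7 / 4 by linarith)
  have h0 := chS_nonneg x
  by_contra h
  push Not at h
  nlinarith [mul_le_mul h h h0 zero_le_two]

/-- `s'(x) = −4x/s(x)` for `x² < 7/4`. [calculus] -/
theorem hasDerivAt_chS {x : ℝ} (hx : x ^ 2 < 7 / 4) : HasDerivAt chS (-(4 * x) / chS x) x := by
  have h1 : HasDerivAt (fun x : ℝ => 7 - 4 * x ^ 2) (-(4 * (2 * x))) x := by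
    simpa using ((hasDerivAt_pow 2 x).const_mul (4 : ℝ)).const_sub 7
  have hne : 7 - 4 * x ^ 2 ≠ 0 := by linarith
  have h2 := h1.sqrt hne
  refine h2.congr_deriv ?_
  rw [chS]
  have hs : 0 < √(7 - 4 * x ^ 2) := Real.sqrt_pos.2 (by linarith)
  field_simp

/-- `g(v) = (1 − v²)²/(1 + v²)³`. -/
def chG (v : ℝ) : ℝ := (1 - v ^ 2) ^ 2 / (1 + v ^ 2) ^ 3

/-- Lemma `chG_nonneg` of the ball-cube descent (gen 5; see the section docstring). [this node] -/
theorem chG_nonneg (v : ℝ) : 0 ≤ chG v := by unfold chG; positivity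

/-- Lemma `chG_le_one` of the ball-cube descent (gen 5; see the section docstring). [this node] -/
theorem chG_le_one {v : ℝ} (h0 : 0 ≤ v) (h1 : v ≤ 1) : chG v ≤ 1 := by
  unfold chG
  rw [div_le_one (by positivity)]
  have hv2 : v ^ 2 ≤ 1 := by nlinarith
  nlinarith [sq_nonneg v, sq_nonneg (v ^ 2), mul_nonneg (sq_nonneg v) (sq_nonneg v),
    mul_nonneg (sq_nonneg v) (mul_nonneg (sq_nonneg v) (sq_nonneg v))]

/-- `d/dv (v/(1 + v²)) = (1 − v²)/(1 + v²)²`. [calculus] -/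
theorem hasDerivAt_vDiv (v : ℝ) :
    HasDerivAt (fun v : ℝ => v / (1 + v ^ 2)) ((1 - v ^ 2) / (1 + v ^ 2) ^ 2) v := by
  have h2 : HasDerivAt (fun s : ℝ => 1 + s ^ 2) (2 * v) v := by
    simpa using (hasDerivAt_pow 2 v).const_add 1
  have hne : (1 + v ^ 2) ≠ 0 := by positivity
  exact ((hasDerivAt_id' v).div h2 hne).congr_deriv (by field_simp; ring)

/-- The chart `Φ(v, x) = (x, s(x)·v/(1 + v²))` (source coordinates `p 0 = v`, `p 1 = x`; target
coordinates `x`, `y`). -/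
def chΦ (p : Fin 2 → ℝ) : Fin 2 → ℝ := ![p 1, chS (p 1) * (p 0 / (1 + p 0 ^ 2))]

/-- Lemma `chΦ_zero` of the ball-cube descent (gen 5; see the section docstring). [this node] -/
@[simp] theorem chΦ_zero (p : Fin 2 → ℝ) : chΦ p 0 = p 1 := rfl

/-- Lemma `chΦ_one` of the ball-cube descent (gen 5; see the section docstring). [this node] -/
@[simp] theorem chΦ_one (p : Fin 2 → ℝ) : chΦ p 1 = chS (p 1) * (p 0 / (1 + p 0 ^ 2)) := rfl

/-- Jacobian matrix of `Φ` (rows `x, y`; columns `v, x`). -/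
def chMat (p : Fin 2 → ℝ) : Matrix (Fin 2) (Fin 2) ℝ :=
  !![0, 1;
     chS (p 1) * ((1 - p 0 ^ 2) / (1 + p 0 ^ 2) ^ 2), -(4 * p 1) / chS (p 1) * (p 0 / (1 + p 0 ^ 2))]

/-- The derivative of `Φ` at `p` as a continuous linear map. -/
def chΦ' (p : Fin 2 → ℝ) : (Fin 2 → ℝ) →L[ℝ] (Fin 2 → ℝ) :=
  LinearMap.toContinuousLinearMap (Matrix.toLin' (chMat p))

/-- Lemma `chΦ'_apply` of the ball-cube descent (gen 5; see the section docstring). [this node] -/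
theorem chΦ'_apply (p v : Fin 2 → ℝ) (a : Fin 2) : chΦ' p v a = ∑ b, chMat p a b * v b := by
  change Matrix.toLin' (chMat p) v a = _
  rw [Matrix.toLin'_apply]
  rfl

/-- `det Φ'(v, x) = −s(x)(1 − v²)/(1 + v²)²`. -/
theorem chΦ'_det (p : Fin 2 → ℝ) :
    (chΦ' p).det = -(chS (p 1) * ((1 - p 0 ^ 2) / (1 + p 0 ^ 2) ^ 2)) := by
  change LinearMap.det (Matrix.toLin' (chMat p)) = _
  rw [LinearMap.det_toLin', Matrix.det_fin_two]
  simp only [chMat, Matrix.of_apply, Matrix.cons_val', Matrix.cons_val_zero, Matrix.cons_val_one,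
    Matrix.cons_val_fin_one, Matrix.empty_val']
  ring

/-- `Φ` is differentiable off `x² ≥ 7/4` with derivative `Φ'`. [calculus] -/
theorem hasFDerivAt_chΦ (p : Fin 2 → ℝ) (hp : p 1 ^ 2 < 7 / 4) : HasFDerivAt chΦ (chΦ' p) p := by
  have hπ0 : HasFDerivAt (𝕜 := ℝ) (fun y : Fin 2 → ℝ => y 0)
      (ContinuousLinearMap.proj (R := ℝ) (φ := fun _ : Fin 2 => ℝ) 0) p := hasFDerivAt_apply 0 p
  have hπ1 : HasFDerivAt (𝕜 := ℝ) (fun y : Fin 2 → ℝ => y 1)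
      (ContinuousLinearMap.proj (R := ℝ) (φ := fun _ : Fin 2 => ℝ) 1) p := hasFDerivAt_apply 1 p
  have hE : HasFDerivAt (fun y : Fin 2 → ℝ => chS (y 1))
      ((-(4 * p 1) / chS (p 1)) • ContinuousLinearMap.proj (R := ℝ) (φ := fun _ : Fin 2 => ℝ) 1) p :=
    HasDerivAt.comp_hasFDerivAt (h₂ := chS) p (hasDerivAt_chS hp) hπ1
  have hT : HasFDerivAt (fun y : Fin 2 → ℝ => y 0 / (1 + y 0 ^ 2))
      (((1 - p 0 ^ 2) / (1 + p 0 ^ 2) ^ 2) •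
        ContinuousLinearMap.proj (R := ℝ) (φ := fun _ : Fin 2 => ℝ) 0) p :=
    HasDerivAt.comp_hasFDerivAt (h₂ := fun v : ℝ => v / (1 + v ^ 2)) p (hasDerivAt_vDiv (p 0)) hπ0
  have h0 : HasFDerivAt (fun y : Fin 2 → ℝ => chΦ y 0)
      ((ContinuousLinearMap.proj 0).comp (chΦ' p)) p := by
    have hf : (fun y : Fin 2 → ℝ => chΦ y 0) = fun y => y 1 := funext chΦ_zero
    rw [hf]
    refine hπ1.congr_fderiv (ContinuousLinearMap.ext fun v => ?_)
    simp [chΦ'_apply, chMat, Fin.sum_univ_two]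
  have h1 : HasFDerivAt (fun y : Fin 2 → ℝ => chΦ y 1)
      ((ContinuousLinearMap.proj 1).comp (chΦ' p)) p := by
    have hf : (fun y : Fin 2 → ℝ => chΦ y 1) = fun y => chS (y 1) * (y 0 / (1 + y 0 ^ 2)) :=
      funext chΦ_one
    rw [hf]
    refine (hE.mul hT).congr_fderiv (ContinuousLinearMap.ext fun v => ?_)
    simp [chΦ'_apply, chMat, Fin.sum_univ_two, smul_eq_mul]
    ring
  refine hasFDerivAt_pi'' fun a => ?_
  fin_cases a
  · exact h0
  · exact h1

/-- `Φ` is injective on `(0,1)²`. -/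
theorem injOn_chΦ : InjOn chΦ boxTwo := by
  intro p hp q hq hpq
  have hp0 := hp 0; have hp1 := hp 1; have hq0 := hq 0
  have hx : p 1 = q 1 := by simpa using congrFun hpq 0
  have hs : 0 < chS (p 1) := chS_pos (by nlinarith [hp1.1, hp1.2])
  have hy : chS (p 1) * (p 0 / (1 + p 0 ^ 2)) = chS (p 1) * (q 0 / (1 + q 0 ^ 2)) := by
    have h := congrFun hpq 1
    simp only [chΦ_one] at h
    rwa [← hx] at h
  have hy' := mul_left_cancel₀ hs.ne' hy
  rw [div_eq_div_iff (by positivity) (by positivity)] at hy'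
  have h3 : (p 0 - q 0) * (1 - p 0 * q 0) = 0 := by linear_combination hy'
  have hv : p 0 = q 0 := by
    rcases mul_eq_zero.1 h3 with h | h
    · linarith
    · nlinarith [mul_lt_mul'' hp0.2 hq0.2 hp0.1.le hq0.1.le]
  funext j
  fin_cases j
  · exact hv
  · exact hx

end Summit.KontsevichZagierPeriods.RootDecompWalshStrata.ConicDescent.BallCube

end
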